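import Literature.Geometry.Kaehler.ComplexTorusIntegralLefschetzFormsDiscriminantIntrinsic
import Literature.Geometry.Kaehler.ComplexTorusIntegralLefschetzDecompositionDegreeThree
import Literature.Geometry.Kaehler.ComplexTorusIntegralLefschetzFormEven
import Literature.Topology.FourManifolds.LatticeFormsOrthogonalDiscriminantRefl
import HarnessLib

/-!
# The Lefschetz form of degree three on the primitive lattice `P³(X, ℤ)` of a polarised complex torus

Layer `Literature/Geometry/Kaehler`, namespace `Literature.Geometry.Kaehler.ComplexTorus`; lane `lit-hodgefound` (Track 2
foundations library), seat p09, generation 42, row g42-#11. THEOREMS ONLY (0 definitions); no named fact, net debt 0.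

Let `X = E/Φ(ℤ^ι)` be a polarised complex torus of type `(d₁, …, d_g)` (`g = j + 3 ≥ 3`, ANY presentation `Φ`), `θ` the
polarisation class, `γ = γ_{g−3} = θ^{∧(g−3)}/((g−3)!·d₁⋯d_{g−3})` and `m = γ_{g−1}` the minimal classes, and
`B₃(a, b) = ⟨a, γ ∧ b⟩ = ±∫ a ∧ γ ∧ b` the integral ALTERNATING Lefschetz form of degree three on `H³(X, ℤ)` (g41-#1, g41-#4).
The odd-degree companion of `ComplexTorusLefschetzFormPrimitiveLattice` (degree two):

* §1 `⟨θ ∧ x, γ ∧ b⟩ = ⟨x, (γ ∧ θ) ∧ b⟩` (graded commutativity and associativity — no sign, `θ` has even degree), hence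
  `N_{g−3}·B₃(θ ∧ x, b) = ⟨x, θ^{∧(g−2)} ∧ b⟩`: the `B₃`-orthogonal complement of `θ ∧ H¹(X, ℤ)` in `H³(X, ℤ)` is the primitive
  lattice `P³(X, ℤ) = H³(X, ℤ) ∩ ker(θ^{∧(g−2)} ∧ (−))`, and ON `θ ∧ H¹(X, ℤ)` the form `B₃` is the degree-one Lefschetz form `B₁`
  scaled: `B₃(θ ∧ x, θ ∧ y) = (g−2)(g−1)·d_{g−2}d_{g−1} · B₁(x, y)`, `B₁(x, y) = ⟨x, γ_{g−1} ∧ y⟩`;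
* §2 **the discriminant of `B₃` on `P³(X, ℤ)`**: for EVERY `ℤ`-basis `c` of `P³(X, ℤ)` with integer Gram matrix `G_P = (⟨c_i, γ ∧ c_{i'}⟩)`,

    `|det G_P| · ((g−2)(g−1)·d_{g−2}d_{g−1})^{2g} · (∏_{a=1}^{g} d_g/d_a)² = [H³ : θ∧H¹ ⊕ P³]² · |disc B₃|`,

  `[H³ : θ∧H¹ ⊕ P³] = (g−1)^{2g}·d_g^{2g−2}·d_{g−1}²` (g38) and `|disc B₃|` the closed product of g41-#1 — Huybrechts' (0.2) for the
  alternating form `B₃` (g42-#10 `det_mul_det_orthogonal_eq_index_sq_mul_of_det_ne_zero_of_isAlt`) and the sublattice `θ ∧ H¹(X, ℤ)`,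
  on which `det B₃ = ((g−2)(g−1)d_{g−2}d_{g−1})^{2g}·disc B₁ ≠ 0`, `|disc B₁| = (∏ d_g/d_a)²` (g41-#1).

Sources: the Lefschetz decomposition `H³ = θ∧H¹ ⊕ P³` over `ℚ` and its failure over `ℤ` up to the finite index above (Lange 2023
§5.4.1 Thm. 5.4.2 and (5.22), PDF p. 275; Voisin 2002 §6.2.3 Cor. 6.26, PDF p. 126), the cup product / Poincaré duality on a torus
(Lange 2023 §6.2.4, PDF p. 310; §1.7.2 Lemma 1.7.5), `disc Λ₁ · disc Λ₂ = disc Λ · [Λ : Λ₁ ⊕ Λ₂]²` (Huybrechts 2016 Ch. 14 (0.2)).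

## References

* [cite: Lange2023AbelianVarietiesComplex, §5.4.1 Thm. 5.4.2 and (5.22) (PDF p. 275); §6.2.4 (PDF p. 310); §2.5.3 Cor. 2.5.17 (PDF p. 135);
  §1.5.1 (PDF p. 51)]
* [cite: VoisinHodgeI2002, §6.2.3 Cor. 6.26 (PDF p. 126); §7.1.2 (PDF p. 134 L31)]
* [cite: Huybrechts2016K3, Ch. 14 §0.1 (0.2)]
* [cite: Warner1983, 2.6]
-/

noncomputable section

open Module Function
open Literature.LinearAlgebra.Alternating

namespace Literature.Geometry.Kaehler.ComplexTorus

/-! ## §0 Wedge bookkeeping -/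

section Helpers

variable {E : Type*} [NormedAddCommGroup E] [NormedSpace ℂ E] {j : ℕ}

/-- `θ ∧ x = x ∧ θ` (reindexed) for `θ` of degree two. [cite: Warner1983, 2.6] -/
private theorem two_wedge_one_eq_domDomCongr₆₀ (θ : E [⋀^Fin 2]→L[ℝ] ℂ) (x : E [⋀^Fin 1]→L[ℝ] ℂ) :
    θ.wedge x = (x.wedge θ).domDomCongr (finCongr (Nat.add_comm 1 2)) := by
  have h : ((-1 : ℝ) ^ (1 * 2)) = 1 := by norm_num
  rw [ContinuousAlternatingMap.WedgeComm_holds ℝ E ℂ x θ, h, one_smul]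

/-- `θ ∧ γ = γ ∧ θ` (reindexed) for `θ` of degree two. [cite: Warner1983, 2.6] -/
private theorem two_wedge_even_eq_domDomCongr₆₀ (θ : E [⋀^Fin 2]→L[ℝ] ℂ) (γ : E [⋀^Fin (2 * j)]→L[ℝ] ℂ) :
    θ.wedge γ = (γ.wedge θ).domDomCongr (finCongr (Nat.add_comm (2 * j) 2)) := by
  have h : ((-1 : ℝ) ^ (2 * j * 2)) = 1 := by rw [mul_assoc, pow_mul, neg_one_sq, one_pow]
  rw [ContinuousAlternatingMap.WedgeComm_holds ℝ E ℂ γ θ, h, one_smul]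

/-- `a ∧ (b ∧ c) = (a ∧ b) ∧ c` (reindexed). [cite: Warner1983, 2.6] -/
private theorem wedge_wedge_eq_domDomCongr_wedge_wedge₆₀ {k l m : ℕ} (a : E [⋀^Fin k]→L[ℝ] ℂ) (b : E [⋀^Fin l]→L[ℝ] ℂ)
    (c : E [⋀^Fin m]→L[ℝ] ℂ) :
    a.wedge (b.wedge c) = ((a.wedge b).wedge c).domDomCongr (finCongr (Nat.add_assoc k l m)) := by
  rw [ContinuousAlternatingMap.WedgeAssoc_holds ℝ E ℂ a b c, domDomCongr_finCongr_trans, domDomCongr_finCongr_self]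

/-- `(j+2)!·d₁⋯d_{j+2} = (j!·d₁⋯d_j) · ((j+1)(j+2)·d_{j+1}d_{j+2})`. [folklore] -/
private theorem content_succ_succ_eq₆₀ (d : Fin (j + 3) → ℕ) (hle : j ≤ j + 3) (hle₂ : j + 1 + 1 ≤ j + 3) :
    (j + 1 + 1).factorial * ∏ i : Fin (j + 1 + 1), d (Fin.castLE hle₂ i) =
      (j.factorial * ∏ i : Fin j, d (Fin.castLE hle i)) *
        ((j + 1) * (j + 2) * d (Fin.last j).castSucc.castSucc * d (Fin.last (j + 1)).castSucc) := by
  have h1 : ∀ i : Fin j, Fin.castLE hle₂ i.castSucc.castSucc = Fin.castLE hle i := fun i ↦ Fin.ext rfl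
  have h2 : Fin.castLE hle₂ (Fin.last j).castSucc = (Fin.last j).castSucc.castSucc := Fin.ext rfl
  have h3 : Fin.castLE hle₂ (Fin.last (j + 1)) = (Fin.last (j + 1)).castSucc := Fin.ext rfl
  rw [Fin.prod_univ_castSucc, Fin.prod_univ_castSucc, Nat.factorial_succ, Nat.factorial_succ, h2, h3]
  simp_rw [h1]
  ring

end Helpers

/-! ## §1 `B₃` against `θ ∧ H¹`: orthogonality to `P³` and the restriction `B₃|_{θ∧H¹} = c·B₁` -/

section ThetaH1

variable {ι : Type*} [Fintype ι] [DecidableEq ι] {E : Type*} [NormedAddCommGroup E] [NormedSpace ℂ E]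
  (Φ : (ι → ℝ) ≃L[ℝ] E) {j n : ℕ}

omit [Fintype ι] in
/-- **`⟨θ ∧ x, γ ∧ b⟩ = ⟨x, (γ ∧ θ) ∧ b⟩`** for a `2`-form `θ`, a `1`-form `x`, a `2j`-form `γ` and a `3`-form `b` (any complex torus, any
orientation): `(θ ∧ x) ∧ (γ ∧ b) = x ∧ ((γ ∧ θ) ∧ b)` by graded commutativity (`θ` has even degree) and associativity.
[cite: Warner1983, 2.6] [cite: Lange2023AbelianVarietiesComplex, §6.2.4 (PDF p. 310)] -/
theorem poincarePairing_two_wedge_one_wedge_eq (e : Fin n ≃ ι) (hn : 3 + (2 * j + 3) = n) (hn' : 1 + (2 * j + 2 + 3) = n)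
    (θ : E [⋀^Fin 2]→L[ℝ] ℂ) (x : E [⋀^Fin 1]→L[ℝ] ℂ) (γ : E [⋀^Fin (2 * j)]→L[ℝ] ℂ) (b : E [⋀^Fin 3]→L[ℝ] ℂ) :
    poincarePairing Φ e hn (θ.wedge x) (γ.wedge b) = poincarePairing Φ e hn' x ((γ.wedge θ).wedge b) := by
  have h1 : θ.wedge (γ.wedge b) = ((γ.wedge θ).wedge b).domDomCongr
      (finCongr (by omega : 2 * j + 2 + 3 = 2 + (2 * j + 3))) := by
    rw [wedge_wedge_eq_domDomCongr_wedge_wedge₆₀, two_wedge_even_eq_domDomCongr₆₀, domDomCongr_finCongr_wedge,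
      domDomCongr_finCongr_trans]
  have h2 : (θ.wedge x).wedge (γ.wedge b) = (x.wedge ((γ.wedge θ).wedge b)).domDomCongr
      (finCongr (by omega : 1 + (2 * j + 2 + 3) = 2 + 1 + (2 * j + 3))) := by
    rw [two_wedge_one_eq_domDomCongr₆₀, domDomCongr_finCongr_wedge, ContinuousAlternatingMap.WedgeAssoc_holds ℝ E ℂ x θ,
      domDomCongr_finCongr_trans, h1, wedge_domDomCongr_finCongr, domDomCongr_finCongr_trans]
  rw [poincarePairing_apply, poincarePairing_apply, h2, ContinuousAlternatingMap.domDomCongr_apply]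
  exact congrArg _ (funext fun i ↦ rfl)

omit [Fintype ι] in
/-- **`⟨x, θ^{∧(q+1)} ∧ (θ ∧ y)⟩ = ⟨x, θ^{∧(q+2)} ∧ y⟩`** (associativity; `θ^{∧(q+2)} = θ^{∧(q+1)} ∧ θ` by definition).
[cite: Warner1983, 2.6] [cite: Lange2023AbelianVarietiesComplex, §6.2.4 (PDF p. 310)] -/
theorem poincarePairing_wedgePow_succ_wedge_two_wedge_eq (e : Fin n ≃ ι) {q : ℕ} (h : 1 + (2 * q + 2 + 3) = n)
    (h' : 1 + (2 * (q + 1) + 2 + 1) = n) (θ : E [⋀^Fin 2]→L[ℝ] ℂ) (x y : E [⋀^Fin 1]→L[ℝ] ℂ) :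
    poincarePairing Φ e h x ((wedgePow θ (q + 1)).wedge (θ.wedge y)) =
      poincarePairing Φ e h' x ((wedgePow θ (q + 1 + 1)).wedge y) := by
  rw [poincarePairing_apply, poincarePairing_apply, wedge_wedge_eq_domDomCongr_wedge_wedge₆₀ (wedgePow θ (q + 1)) θ y, ← wedgePow_succ,
    wedge_domDomCongr_finCongr, ContinuousAlternatingMap.domDomCongr_apply]
  exact congrArg _ (funext fun i ↦ rfl)

variable {η : E [⋀^Fin 2]→L[ℝ] ℝ} {d : Fin (j + 3) → ℕ}

omit [Fintype ι] in
/-- **`N_{g−3} · B₃(θ ∧ x, b) = ⟨x, θ^{∧(g−2)} ∧ b⟩`** (`g = j + 3`, type `(d₁, …, d_g)`, `θ^{∧(g−3)} = N_{g−3}·γ`, `N_{g−3} = (g−3)!·d₁⋯d_{g−3}`,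
`B₃(a, b) = ⟨a, γ ∧ b⟩`): the Lefschetz form of degree three against `θ ∧ H¹` is the Poincaré pairing with `θ^{∧(g−2)} ∧ (−)`.
[cite: Lange2023AbelianVarietiesComplex, §5.4.1 (5.22) (PDF p. 275); §6.2.4 (PDF p. 310)] [cite: Warner1983, 2.6] -/
theorem content_mul_poincarePairing_ofRealForm_wedge_one_wedge_eq (hle : j ≤ j + 3) {γ : E [⋀^Fin (2 * j)]→L[ℝ] ℂ}
    (hγ : wedgePow (ofRealForm η) j = ((j.factorial * ∏ i : Fin j, d (Fin.castLE hle i) : ℕ) : ℂ) • γ)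
    (e : Fin n ≃ ι) (hn : 3 + (2 * j + 3) = n) (hn' : 1 + (2 * j + 2 + 3) = n) (x : E [⋀^Fin 1]→L[ℝ] ℂ) (b : E [⋀^Fin 3]→L[ℝ] ℂ) :
    ((j.factorial * ∏ i : Fin j, d (Fin.castLE hle i) : ℕ) : ℂ) *
        poincarePairing Φ e hn ((ofRealForm η : E [⋀^Fin 2]→L[ℝ] ℂ).wedge x) (γ.wedge b) =
      poincarePairing Φ e hn' x ((wedgePow (ofRealForm η) (j + 1)).wedge b) := by
  rw [poincarePairing_two_wedge_one_wedge_eq Φ e hn hn', wedgePow_succ, hγ, wedge_smul_left_complex, wedge_smul_left_complex,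
    map_smul, smul_eq_mul]

variable {Φ}

/-- **`P³(X, ℤ) = (θ ∧ H¹(X, ℤ))^{⊥B₃}`**: for a `3`-form `b`, `B₃(θ ∧ x, b) = 0` for every `x ∈ H¹(X, ℤ)` iff `θ^{∧(g−2)} ∧ b = 0`
(`g = j + 3`; the integral classes `dx_w` separate `H^{2g−1}(X, ℂ)` under the Poincaré pairing). [cite: Lange2023AbelianVarietiesComplex, §5.4.1 Thm. 5.4.2 and (5.22) (PDF p. 275); §6.2.4 (PDF p. 310); §1.1.4 Prop. 1.1.20] [cite: VoisinHodgeI2002, §6.2.3 Cor. 6.26 (PDF p. 126)] -/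
theorem IsPolarizationType.forall_poincarePairing_ofRealForm_wedge_one_wedge_eq_zero_iff_of_eq_content_smul
    (hd : IsPolarizationType Φ η d) (hη : IsRiemannForm Φ η) (hle : j ≤ j + 3) {γ : E [⋀^Fin (2 * j)]→L[ℝ] ℂ}
    (hγ : wedgePow (ofRealForm η) j = ((j.factorial * ∏ i : Fin j, d (Fin.castLE hle i) : ℕ) : ℂ) • γ)
    (e : Fin n ≃ ι) (hn : 3 + (2 * j + 3) = n) (b : E [⋀^Fin 3]→L[ℝ] ℂ) :
    (∀ x ∈ integralForms Φ 1, poincarePairing Φ e hn ((ofRealForm η : E [⋀^Fin 2]→L[ℝ] ℂ).wedge x) (γ.wedge b) = 0) ↔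
      (wedgePow (ofRealForm η) (j + 1)).wedge b = 0 := by
  have hn' : 1 + (2 * j + 2 + 3) = n := by omega
  have hN : ((j.factorial * ∏ i : Fin j, d (Fin.castLE hle i) : ℕ) : ℂ) ≠ 0 := by
    exact_mod_cast (Nat.mul_pos (Nat.factorial_pos j) (Finset.prod_pos fun i _ ↦ hd.pos hη _)).ne'
  have key : ∀ x, poincarePairing Φ e hn ((ofRealForm η : E [⋀^Fin 2]→L[ℝ] ℂ).wedge x) (γ.wedge b) = 0 ↔
      poincarePairing Φ e hn' x ((wedgePow (ofRealForm η) (j + 1)).wedge b) = 0 := fun x ↦ by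
    rw [← content_mul_poincarePairing_ofRealForm_wedge_one_wedge_eq Φ hle hγ e hn hn', mul_eq_zero, or_iff_right hN]
  letI : LinearOrder ι := linearOrderOfOrientation e
  constructor
  · intro h
    exact eq_zero_of_forall_poincarePairing_latMonomial_eq_zero' Φ e hn' fun w ↦
      (key _).1 (h _ (latMonomial_mem_integralForms Φ 1 w.1))
  · intro h x _
    rw [key, h, map_zero]

/-- **`B₃(θ ∧ x, θ ∧ y) = (g−2)(g−1)·d_{g−2}d_{g−1} · B₁(x, y)`** (`g = j + 3`, `B₃(a, b) = ⟨a, γ_{g−3} ∧ b⟩`, `B₁(x, y) = ⟨x, γ_{g−1} ∧ y⟩`): on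
`θ ∧ H¹(X)` the Lefschetz form of degree three IS the Lefschetz form of degree one, scaled by `N_{g−1}/N_{g−3}`.
[cite: Lange2023AbelianVarietiesComplex, §5.4.1 (5.22) (PDF p. 275); §2.5.3 Cor. 2.5.17 (PDF p. 135); §6.2.4 (PDF p. 310)] [cite: Warner1983, 2.6] -/
theorem IsPolarizationType.poincarePairing_ofRealForm_wedge_one_wedge_ofRealForm_wedge_one_of_eq_content_smul
    (hd : IsPolarizationType Φ η d) (hη : IsRiemannForm Φ η) (hle : j ≤ j + 3) {γ : E [⋀^Fin (2 * j)]→L[ℝ] ℂ}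
    (hγ : wedgePow (ofRealForm η) j = ((j.factorial * ∏ i : Fin j, d (Fin.castLE hle i) : ℕ) : ℂ) • γ)
    (hle₂ : j + 1 + 1 ≤ j + 3) {m : E [⋀^Fin (2 * (j + 1 + 1))]→L[ℝ] ℂ}
    (hm : wedgePow (ofRealForm η) (j + 1 + 1) = (((j + 1 + 1).factorial * ∏ i : Fin (j + 1 + 1), d (Fin.castLE hle₂ i) : ℕ) : ℂ) • m)
    (e : Fin n ≃ ι) (hn : 3 + (2 * j + 3) = n) (h₁ : 1 + (2 * (j + 1) + 3) = n) (x y : E [⋀^Fin 1]→L[ℝ] ℂ) :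
    poincarePairing Φ e hn ((ofRealForm η : E [⋀^Fin 2]→L[ℝ] ℂ).wedge x)
        (γ.wedge ((ofRealForm η : E [⋀^Fin 2]→L[ℝ] ℂ).wedge y)) =
      (((j + 1) * (j + 2) * d (Fin.last j).castSucc.castSucc * d (Fin.last (j + 1)).castSucc : ℕ) : ℂ) *
        poincarePairing Φ e h₁ x (m.wedge y : E [⋀^Fin (2 * (j + 1) + 3)]→L[ℝ] ℂ) := by
  have hn' : 1 + (2 * j + 2 + 3) = n := by omega
  have hN : ((j.factorial * ∏ i : Fin j, d (Fin.castLE hle i) : ℕ) : ℂ) ≠ 0 := by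
    exact_mod_cast (Nat.mul_pos (Nat.factorial_pos j) (Finset.prod_pos fun i _ ↦ hd.pos hη _)).ne'
  have h1 := content_mul_poincarePairing_ofRealForm_wedge_one_wedge_eq Φ hle hγ e hn hn' x ((ofRealForm η : E [⋀^Fin 2]→L[ℝ] ℂ).wedge y)
  rw [poincarePairing_wedgePow_succ_wedge_two_wedge_eq Φ e hn' h₁, hm, wedge_smul_left_complex, map_smul, smul_eq_mul,
    content_succ_succ_eq₆₀ d hle hle₂, Nat.cast_mul (j.factorial * ∏ i : Fin j, d (Fin.castLE hle i))
      ((j + 1) * (j + 2) * d (Fin.last j).castSucc.castSucc * d (Fin.last (j + 1)).castSucc), mul_assoc] at h1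
  exact mul_left_cancel₀ hN h1

end ThetaH1

/-! ## §2 The discriminant of `B₃` on the primitive lattice `P³(X, ℤ)` -/

section PrimitiveDiscriminant

variable {ι : Type*} [Fintype ι] [DecidableEq ι] {E : Type*} [NormedAddCommGroup E] [NormedSpace ℂ E]
  {Φ : (ι → ℝ) ≃L[ℝ] E} {j n : ℕ} {η : E [⋀^Fin 2]→L[ℝ] ℝ} {d : Fin (j + 3) → ℕ}

omit [DecidableEq ι] in
/-- Increasing words of length one are the letters. [folklore] -/
private theorem card_strictMono_one₆₀ [LinearOrder ι] : Fintype.card {w : Fin 1 → ι // StrictMono w} = Fintype.card ι :=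
  Fintype.card_congr
    { toFun := fun w ↦ w.1 0
      invFun := fun i ↦ ⟨fun _ ↦ i, fun a b hab ↦ absurd (Subsingleton.elim a b) hab.ne⟩
      left_inv := fun w ↦ Subtype.ext (funext fun k ↦ congrArg w.1 (Subsingleton.elim 0 k))
      right_inv := fun _ ↦ rfl }

set_option maxHeartbeats 1600000 in
/-- **The discriminant of the Lefschetz form of degree three on the primitive lattice.** For a polarised complex torus `X` of type
`(d₁, …, d_g)` (`g = j + 3`, any presentation `Φ`, any orientation `e`), the minimal class `γ = γ_{g−3}`, the primitive lattice
`P³(X, ℤ) = H³(X, ℤ) ∩ ker(θ^{∧(g−2)} ∧ (−))`, EVERY `ℤ`-basis `c` of `P³(X, ℤ)` and its integer Gram matrix `G_P = (⟨c_i, γ ∧ c_{i'}⟩_e)`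
(an alternating matrix):

  `|det G_P| · ((g−2)(g−1)·d_{g−2}d_{g−1})^{2g} · (∏_{a=1}^{g} d_g/d_a)² = ((g−1)^{2g}·d_g^{2g−2}·d_{g−1}²)² · |disc B₃|`,

`|disc B₃|` the discriminant of `B₃` on `H³(X, ℤ)` (the closed product of g41-#1). Proof: Huybrechts' (0.2) for the ALTERNATING form `B₃`
on `H³(X, ℤ)` and the sublattice `θ ∧ H¹(X, ℤ)` (§1: its `B₃`-orthogonal complement is `P³(X, ℤ)` and `B₃|_{θ∧H¹} = (g−2)(g−1)d_{g−2}d_{g−1}·B₁`,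
`|disc B₁| = (∏ d_g/d_a)²`), with `[H³ : θ∧H¹ ⊕ P³] = (g−1)^{2g}·d_g^{2g−2}·d_{g−1}²` (g38).
[cite: Huybrechts2016K3, Ch. 14 §0.1 (0.2)] [cite: Lange2023AbelianVarietiesComplex, §5.4.1 Thm. 5.4.2 and (5.22) (PDF p. 275); §6.2.4 (PDF p. 310); §1.5.1 (PDF p. 51)] [cite: VoisinHodgeI2002, §6.2.3 Cor. 6.26 (PDF p. 126); §7.1.2 (PDF p. 134 L31)] -/
theorem IsPolarizationType.natAbs_det_poincarePairing_wedge_integralPrimitive_three_mul_of_eq_content_smul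
    (hd : IsPolarizationType Φ η d) (hη : IsRiemannForm Φ η) (hle : j ≤ j + 3) {γ : E [⋀^Fin (2 * j)]→L[ℝ] ℂ}
    (hγ : wedgePow (ofRealForm η) j = ((j.factorial * ∏ i : Fin j, d (Fin.castLE hle i) : ℕ) : ℂ) • γ)
    (e : Fin n ≃ ι) (hn : 3 + (2 * j + 3) = n) {κ : Type*} [Fintype κ] [DecidableEq κ]
    (c : Basis κ ℤ ↥(integralForms Φ 3 ⊓ (AddMonoidHom.mk'
      (fun x : E [⋀^Fin 3]→L[ℝ] ℂ ↦ (wedgePow (ofRealForm η) (j + 1)).wedge x) (ContinuousAlternatingMap.wedge_add_right _)).ker))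
    (GP : Matrix κ κ ℤ) (hGP : ∀ i i', (GP i i' : ℂ) =
      poincarePairing Φ e hn (c i : E [⋀^Fin 3]→L[ℝ] ℂ) (γ.wedge (c i' : E [⋀^Fin 3]→L[ℝ] ℂ))) :
    GP.det.natAbs * ((j + 1) * (j + 2) * d (Fin.last j).castSucc.castSucc * d (Fin.last (j + 1)).castSucc) ^ (2 * (j + 3)) *
        (∏ a : Fin (j + 3), (d (Fin.last (j + 2)) / d a)) ^ 2 =
      ((j + 2) ^ (2 * (j + 3)) * d (Fin.last (j + 2)) ^ (2 * (j + 2)) * d (Fin.last (j + 1)).castSucc ^ 2) ^ 2 *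
        ((∏ u : {u : Fin 3 → Fin (j + 3) ⊕ Fin (j + 3) //
            Sum.elim id id (u 0) < Sum.elim id id (u 1) ∧ Sum.elim id id (u 1) < Sum.elim id id (u 2)},
          (∏ ν ∈ (Finset.univ.image fun t ↦ Sum.elim id id (u.1 t))ᶜ, d ν) / ∏ i : Fin j, d (Fin.castLE hle i)) *
        ∏ x : Fin (j + 3) ⊕ Fin (j + 3), ((j + 1) *
          ((∏ i : Fin j, (d (Fin.last j).castSucc.castSucc / d (Fin.castLE hle i)) *
              (d (Fin.last (j + 1)).castSucc / d (Fin.castLE hle i))) *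
            (d (Fin.last (j + 2)) / d (Sum.elim id id x)) ^ j))) := by
  -- membership in the primitive lattice `P³(X, ℤ)`
  have hmemK : ∀ {x : E [⋀^Fin 3]→L[ℝ] ℂ}, x ∈ integralForms Φ 3 ⊓ (AddMonoidHom.mk'
      (fun x : E [⋀^Fin 3]→L[ℝ] ℂ ↦ (wedgePow (ofRealForm η) (j + 1)).wedge x) (ContinuousAlternatingMap.wedge_add_right _)).ker ↔
      x ∈ integralForms Φ 3 ∧ (wedgePow (ofRealForm η) (j + 1)).wedge x = 0 :=
    fun {x} ↦ by rw [AddSubgroup.mem_inf, AddMonoidHom.mem_ker]; rfl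
  have hθH : (ofRealForm η : E [⋀^Fin 2]→L[ℝ] ℂ) ∈ integralForms Φ 2 := ofRealForm_mem_integralForms_two Φ hη.isNSForm
  have hγZ : γ ∈ integralForms Φ (2 * j) := by
    obtain ⟨Φ', hΛ, hs⟩ := hd.exists_isSymplecticEnum Φ
    obtain ⟨γ', hγ'Z, hγ'⟩ := hd.exists_mem_integralForms_wedgePow_eq_content_smul hle
    rwa [hs.eq_of_wedgePow_eq_content_smul Φ' (hη.of_range_latticeVec_subset hΛ.le) hle hγ hγ']
  -- the minimal curve-type class `m = γ_{g−1}`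
  have hle₂ : j + 1 + 1 ≤ j + 3 := by omega
  obtain ⟨m, hmZ, hm⟩ := hd.exists_mem_integralForms_wedgePow_eq_content_smul hle₂
  have h₁ : 1 + (2 * (j + 1) + 3) = n := by omega
  have hcN : (j + 1) * (j + 2) * d (Fin.last j).castSucc.castSucc * d (Fin.last (j + 1)).castSucc ≠ 0 :=
    (Nat.mul_pos (Nat.mul_pos (Nat.mul_pos (by omega) (by omega)) (hd.pos hη _)) (hd.pos hη _)).ne'
  -- `H³(X, ℤ)`, `H¹(X, ℤ)` as finite free `ℤ`-modules
  letI : LinearOrder ι := linearOrderOfOrientation e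
  let bH : Basis {w : Fin 3 → ι // StrictMono w} ℤ ↥(integralForms Φ 3) := intLatMonomialBasis Φ 3
  let b1 : Basis {w : Fin 1 → ι // StrictMono w} ℤ ↥(integralForms Φ 1) := intLatMonomialBasis Φ 1
  haveI : Module.Free ℤ ↥(integralForms Φ 3) := Module.Free.of_basis bH
  haveI : Module.Finite ℤ ↥(integralForms Φ 3) := Module.Finite.of_basis bH
  haveI : IsAddTorsionFree (E [⋀^Fin 3]→L[ℝ] ℂ) := IsAddTorsionFree.of_isTorsionFree ℂ _
  haveI : IsTorsionFree ℤ ↥(integralForms Φ 3) := Function.Injective.moduleIsTorsionFree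
    (Subtype.val : ↥(integralForms Φ 3) → E [⋀^Fin 3]→L[ℝ] ℂ) Subtype.val_injective fun _ _ ↦ rfl
  have hcard : Fintype.card {w : Fin 1 → ι // StrictMono w} = 2 * (j + 3) := by rw [card_strictMono_one₆₀, hd.card_eq]
  -- the integral alternating Lefschetz form `B₃(x, y) = ⟨x, γ ∧ y⟩` on `H³(X, ℤ)`
  obtain ⟨P, hP⟩ := exists_pairing_eq_poincarePairing Φ e hn (k := 3) (l := 2 * j + 3)
  let Lγ : ↥(integralForms Φ 3) →ₗ[ℤ] ↥(integralForms Φ (2 * j + 3)) :=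
    (((AddMonoidHom.mk' (fun x : E [⋀^Fin 3]→L[ℝ] ℂ ↦ γ.wedge x) (ContinuousAlternatingMap.wedge_add_right _)).comp
      (integralForms Φ 3).subtype).codRestrict (integralForms Φ (2 * j + 3)) fun x ↦ wedge_mem_integralForms Φ hγZ x.2).toIntLinearMap
  have hLγ : ∀ x : ↥(integralForms Φ 3), (Lγ x : E [⋀^Fin (2 * j + 3)]→L[ℝ] ℂ) = γ.wedge (x : E [⋀^Fin 3]→L[ℝ] ℂ) := fun _ ↦ rfl
  let B : LinearMap.BilinForm ℤ ↥(integralForms Φ 3) := P.compl₂ Lγ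
  have hB : ∀ x y : ↥(integralForms Φ 3),
      ((B x y : ℤ) : ℂ) = poincarePairing Φ e hn (x : E [⋀^Fin 3]→L[ℝ] ℂ) (γ.wedge (y : E [⋀^Fin 3]→L[ℝ] ℂ)) :=
    fun x y ↦ by rw [LinearMap.compl₂_apply, hP, hLγ]
  have hBalt : B.IsAlt := fun x ↦ by
    apply Int.cast_injective (α := ℂ)
    rw [hB, Int.cast_zero]
    exact poincarePairing_wedge_self_eq_zero_of_odd Φ ⟨1, rfl⟩ e hn _ γ
  -- the integral Lefschetz form `B₁(x, y) = ⟨x, m ∧ y⟩` on `H¹(X, ℤ)`: Gram matrix `G₁` in the basis `b1`, `det G₁ ≠ 0`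
  have h₁' : 1 + (2 * (j + 1 + 1) + 1) = n := by omega
  obtain ⟨P₁, hP₁⟩ := exists_pairing_eq_poincarePairing Φ e h₁' (k := 1) (l := 2 * (j + 1 + 1) + 1)
  let Lm : ↥(integralForms Φ 1) →ₗ[ℤ] ↥(integralForms Φ (2 * (j + 1 + 1) + 1)) :=
    (((AddMonoidHom.mk' (fun x : E [⋀^Fin 1]→L[ℝ] ℂ ↦ m.wedge x) (ContinuousAlternatingMap.wedge_add_right _)).comp
      (integralForms Φ 1).subtype).codRestrict (integralForms Φ (2 * (j + 1 + 1) + 1)) fun x ↦ wedge_mem_integralForms Φ hmZ x.2).toIntLinearMap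
  have hLm : ∀ x : ↥(integralForms Φ 1), (Lm x : E [⋀^Fin (2 * (j + 1 + 1) + 1)]→L[ℝ] ℂ) = m.wedge (x : E [⋀^Fin 1]→L[ℝ] ℂ) :=
    fun _ ↦ rfl
  -- (`G₁` is introduced as an opaque matrix with its defining equation: unfolding a `Matrix.det` of an explicit
  -- lambda-matrix is prohibitively expensive for the elaborator)
  obtain ⟨G₁, hG₁Z⟩ : ∃ G : Matrix {w : Fin 1 → ι // StrictMono w} {w : Fin 1 → ι // StrictMono w} ℤ,
      ∀ i k, G i k = P₁ (b1 i) (Lm (b1 k)) := ⟨fun i k ↦ P₁ (b1 i) (Lm (b1 k)), fun _ _ ↦ rfl⟩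
  have hG₁ : ∀ i k, (G₁ i k : ℂ) = poincarePairing Φ e h₁' (b1 i : E [⋀^Fin 1]→L[ℝ] ℂ) (m.wedge (b1 k : E [⋀^Fin 1]→L[ℝ] ℂ)) :=
    fun i k ↦ by rw [hG₁Z, hP₁, hLm]
  have hG₁det : G₁.det.natAbs = (∏ a : Fin (j + 3), (d (Fin.last (j + 2)) / d a)) ^ 2 :=
    hd.natAbs_det_poincarePairing_wedge_one_of_eq_content_smul hη hle₂ hm e h₁ b1 G₁ fun i k ↦ hG₁ i k
  have hG₁ne : G₁.det ≠ 0 := fun h0 ↦ by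
    have h1 := hG₁det
    rw [h0, Int.natAbs_zero] at h1
    exact pow_ne_zero 2 (Finset.prod_ne_zero_iff.2 fun a _ ↦
      (Nat.div_pos (Nat.le_of_dvd (hd.pos hη _) (hd.dvd (Fin.le_last a))) (hd.pos hη a)).ne') h1.symm
  -- `T : x ↦ θ ∧ x`, `H¹(X, ℤ) → H³(X, ℤ)`; `B(T x, T y) = c_N · B₁(x, y)`
  let T : ↥(integralForms Φ 1) →ₗ[ℤ] ↥(integralForms Φ 3) :=
    (((AddMonoidHom.mk' (fun x : E [⋀^Fin 1]→L[ℝ] ℂ ↦ ((ofRealForm η : E [⋀^Fin 2]→L[ℝ] ℂ).wedge x : E [⋀^Fin 3]→L[ℝ] ℂ))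
      (ContinuousAlternatingMap.wedge_add_right _)).comp
      (integralForms Φ 1).subtype).codRestrict (integralForms Φ 3) fun x ↦ wedge_mem_integralForms Φ hθH x.2).toIntLinearMap
  have hT : ∀ x : ↥(integralForms Φ 1), (T x : E [⋀^Fin 3]→L[ℝ] ℂ) = (ofRealForm η : E [⋀^Fin 2]→L[ℝ] ℂ).wedge (x : E [⋀^Fin 1]→L[ℝ] ℂ) :=
    fun _ ↦ rfl
  have hBT : ∀ x y : ↥(integralForms Φ 1), B (T x) (T y) =
      ((j + 1) * (j + 2) * d (Fin.last j).castSucc.castSucc * d (Fin.last (j + 1)).castSucc : ℕ) * P₁ x (Lm y) := fun x y ↦ by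
    apply Int.cast_injective (α := ℂ)
    rw [hB, hT, hT, Int.cast_mul, Int.cast_natCast, hP₁, hLm]
    exact hd.poincarePairing_ofRealForm_wedge_one_wedge_ofRealForm_wedge_one_of_eq_content_smul hη hle hγ hle₂ hm e hn h₁ _ _
  -- `T` is injective on `H¹(X, ℤ)` (`det G₁ ≠ 0`)
  have hTinj : Injective T := by
    rw [← LinearMap.ker_eq_bot, LinearMap.ker_eq_bot']
    intro x hx
    have hsol : G₁.mulVec (b1.repr x) = 0 := by
      funext k
      have h1 : B (T (b1 k)) (T x) = 0 := by rw [hx]; exact LinearMap.map_zero _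
      rw [hBT] at h1
      have h2 : P₁ (b1 k) (Lm x) = 0 := (mul_eq_zero.1 h1).resolve_left (by exact_mod_cast hcN)
      have h3 : P₁ (b1 k) (Lm x) = ∑ i, G₁ k i * b1.repr x i := by
        conv_lhs => rw [← b1.sum_repr x]
        simp only [map_sum, map_zsmul, smul_eq_mul]
        exact Finset.sum_congr rfl fun i _ ↦ by rw [hG₁Z, mul_comm]
      rw [Pi.zero_apply, Matrix.mulVec, dotProduct, ← h3, h2]
    have h4 : (b1.repr x : {w : Fin 1 → ι // StrictMono w} → ℤ) = 0 := Matrix.eq_zero_of_mulVec_eq_zero hG₁ne hsol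
    exact b1.repr.map_eq_zero_iff.1 (Finsupp.coe_eq_zero.1 h4)
  -- the sublattice `L = θ ∧ H¹(X, ℤ)` of `H³(X, ℤ)`, its basis `θ ∧ b1`, `det G_L = c_N^{2g} · det G₁ ≠ 0`
  let L : Submodule ℤ ↥(integralForms Φ 3) := LinearMap.range T
  let bL : Basis {w : Fin 1 → ι // StrictMono w} ℤ ↥L := b1.map (LinearEquiv.ofInjective T hTinj)
  have hbL : ∀ i, ((bL i : ↥L) : ↥(integralForms Φ 3)) = T (b1 i) := fun i ↦ by
    rw [Basis.map_apply, LinearEquiv.ofInjective_apply]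
  have hGL : LinearMap.BilinForm.toMatrix bL (B.restrict L) =
      (((j + 1) * (j + 2) * d (Fin.last j).castSucc.castSucc * d (Fin.last (j + 1)).castSucc : ℕ) : ℤ) • G₁ := by
    ext i k
    rw [LinearMap.BilinForm.toMatrix_apply, Matrix.smul_apply, smul_eq_mul]
    show B ((bL i : ↥L) : ↥(integralForms Φ 3)) ((bL k : ↥L) : ↥(integralForms Φ 3)) = _
    rw [hbL, hbL, hBT, hG₁Z]
  have hdetL : (LinearMap.BilinForm.toMatrix bL (B.restrict L)).det =
      (((j + 1) * (j + 2) * d (Fin.last j).castSucc.castSucc * d (Fin.last (j + 1)).castSucc : ℕ) : ℤ) ^ (2 * (j + 3)) * G₁.det := by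
    rw [hGL, Matrix.det_smul, hcard]
  have hdetL0 : (LinearMap.BilinForm.toMatrix bL (B.restrict L)).det ≠ 0 := by
    rw [hdetL]
    exact mul_ne_zero (pow_ne_zero _ (by exact_mod_cast hcN)) hG₁ne
  -- its `B₃`-orthogonal complement is the primitive lattice `P³(X, ℤ)`
  have hmemN : ∀ y : ↥(integralForms Φ 3), y ∈ B.orthogonal L ↔
      (wedgePow (ofRealForm η) (j + 1)).wedge (y : E [⋀^Fin 3]→L[ℝ] ℂ) = 0 := fun y ↦ by
    rw [LinearMap.BilinForm.mem_orthogonal_iff,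
      ← hd.forall_poincarePairing_ofRealForm_wedge_one_wedge_eq_zero_iff_of_eq_content_smul hη hle hγ e hn]
    constructor
    · intro h x hx
      have h1 : B (T ⟨x, hx⟩) y = 0 := h _ ⟨⟨x, hx⟩, rfl⟩
      have h2 := hB (T ⟨x, hx⟩) y
      rw [h1, Int.cast_zero] at h2
      exact h2.symm
    · rintro h _ ⟨x, rfl⟩
      show B (T x) y = 0
      apply Int.cast_injective (α := ℂ)
      rw [hB, Int.cast_zero]
      exact h x x.2
  -- `[H³(X, ℤ) : θ ∧ H¹ ⊕ P³] = (g−1)^{2g}·d_g^{2g−2}·d_{g−1}²`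
  have hsub : (L ⊔ B.orthogonal L).toAddSubgroup =
      ((integralForms Φ 1).map (AddMonoidHom.mk'
        (fun x : E [⋀^Fin 1]→L[ℝ] ℂ ↦ ((ofRealForm η : E [⋀^Fin 2]→L[ℝ] ℂ).wedge x : E [⋀^Fin 3]→L[ℝ] ℂ))
        (ContinuousAlternatingMap.wedge_add_right _)) ⊔
      (integralForms Φ 3 ⊓ (AddMonoidHom.mk'
        (fun x : E [⋀^Fin 3]→L[ℝ] ℂ ↦ (wedgePow (ofRealForm η) (j + 1)).wedge x)
        (ContinuousAlternatingMap.wedge_add_right _)).ker)).addSubgroupOf (integralForms Φ 3) := by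
    ext x
    simp only [Submodule.mem_toAddSubgroup, Submodule.mem_sup, AddSubgroup.mem_addSubgroupOf, AddSubgroup.mem_sup]
    constructor
    · rintro ⟨y, ⟨x₁, rfl⟩, z, hz, rfl⟩
      exact ⟨(T x₁ : E [⋀^Fin 3]→L[ℝ] ℂ), ⟨(x₁ : E [⋀^Fin 1]→L[ℝ] ℂ), x₁.2, rfl⟩,
        (z : E [⋀^Fin 3]→L[ℝ] ℂ), hmemK.2 ⟨z.2, (hmemN z).1 hz⟩, rfl⟩
    · rintro ⟨a, ⟨x₁, hx₁, rfl⟩, k, hk, hx⟩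
      obtain ⟨hkH, hkW⟩ := hmemK.1 hk
      exact ⟨T ⟨x₁, hx₁⟩, ⟨⟨x₁, hx₁⟩, rfl⟩, ⟨k, hkH⟩, (hmemN ⟨k, hkH⟩).2 hkW, Subtype.ext hx⟩
  have hidx : (L ⊔ B.orthogonal L).toAddSubgroup.index =
      (j + 2) ^ (2 * (j + 3)) * d (Fin.last (j + 2)) ^ (2 * (j + 2)) * d (Fin.last (j + 1)).castSucc ^ 2 := by
    rw [hsub]
    exact hd.relIndex_map_wedge_sup_integralPrimitive_three hη
  -- transport the basis `c` of `P³(X, ℤ)` to the orthogonal complement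
  let eK : ↥(integralForms Φ 3 ⊓ (AddMonoidHom.mk' (fun x : E [⋀^Fin 3]→L[ℝ] ℂ ↦ (wedgePow (ofRealForm η) (j + 1)).wedge x)
      (ContinuousAlternatingMap.wedge_add_right _)).ker) ≃ₗ[ℤ] ↥(B.orthogonal L) :=
    { toFun := fun k ↦ ⟨⟨(k : E [⋀^Fin 3]→L[ℝ] ℂ), (hmemK.1 k.2).1⟩, (hmemN _).2 (hmemK.1 k.2).2⟩
      invFun := fun z ↦ ⟨((z : ↥(integralForms Φ 3)) : E [⋀^Fin 3]→L[ℝ] ℂ),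
        hmemK.2 ⟨(z : ↥(integralForms Φ 3)).2, (hmemN _).1 z.2⟩⟩
      left_inv := fun _ ↦ rfl
      right_inv := fun _ ↦ rfl
      map_add' := fun _ _ ↦ rfl
      map_smul' := fun _ _ ↦ rfl }
  let bN : Basis κ ℤ ↥(B.orthogonal L) := c.map eK
  have hbN : ∀ i, ((bN i : ↥(integralForms Φ 3)) : E [⋀^Fin 3]→L[ℝ] ℂ) = (c i : E [⋀^Fin 3]→L[ℝ] ℂ) := fun i ↦ by
    rw [Basis.map_apply]; rfl
  -- the Gram matrices of `P³` and of `H³`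
  have hGN : LinearMap.BilinForm.toMatrix bN (B.restrict (B.orthogonal L)) = GP := by
    ext i i'
    apply Int.cast_injective (α := ℂ)
    rw [LinearMap.BilinForm.toMatrix_apply, hGP]
    show (((B (bN i : ↥(integralForms Φ 3)) (bN i' : ↥(integralForms Φ 3)) : ℤ) : ℂ)) = _
    rw [hB, hbN, hbN]
  have hGH := hd.natAbs_det_poincarePairing_wedge_three_of_eq_content_smul hη hle hγ e hn bH (LinearMap.BilinForm.toMatrix bH B)
    fun i i' ↦ by rw [LinearMap.BilinForm.toMatrix_apply, hB]
  -- Huybrechts' (0.2) for the alternating form `B₃`: `det G_L · det G_P = [H³ : L ⊕ P³]² · det G_{H³}`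
  have h02 := LinearMap.BilinForm.det_mul_det_orthogonal_eq_index_sq_mul_of_det_ne_zero_of_isAlt B L hBalt bH bL bN hdetL0
  have key : (((j + 1) * (j + 2) * d (Fin.last j).castSucc.castSucc * d (Fin.last (j + 1)).castSucc : ℕ) : ℤ) ^ (2 * (j + 3)) *
      G₁.det * GP.det = ((L ⊔ B.orthogonal L).toAddSubgroup.index : ℤ) ^ 2 * (LinearMap.BilinForm.toMatrix bH B).det :=
    (congrArg₂ (· * ·) hdetL (congrArg Matrix.det hGN)).symm.trans h02
  -- absolute values
  have hnat := congrArg Int.natAbs key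
  rw [Int.natAbs_mul, Int.natAbs_mul, Int.natAbs_pow, Int.natAbs_natCast, hG₁det, Int.natAbs_mul, Int.natAbs_pow,
    Int.natAbs_natCast, hGH, hidx] at hnat
  calc GP.det.natAbs * ((j + 1) * (j + 2) * d (Fin.last j).castSucc.castSucc * d (Fin.last (j + 1)).castSucc) ^ (2 * (j + 3)) *
        (∏ a : Fin (j + 3), (d (Fin.last (j + 2)) / d a)) ^ 2
      = ((j + 1) * (j + 2) * d (Fin.last j).castSucc.castSucc * d (Fin.last (j + 1)).castSucc) ^ (2 * (j + 3)) *
        (∏ a : Fin (j + 3), (d (Fin.last (j + 2)) / d a)) ^ 2 * GP.det.natAbs := by ring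
    _ = _ := hnat

end PrimitiveDiscriminant

end Literature.Geometry.Kaehler.ComplexTorus
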